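import Summits.QuantumAdvantage.QuantumAdvantage.Theses.ArithStatLadder
import Literature.Computability.Cryptography.HallgrenClassGroup
import Literature.NumberTheory.QuadraticFields.ClassNumberOneLandauProofs
import Literature.Computability.Complexity.CircuitClassesProofs
import Literature.Computability.Complexity.CircuitComposition
import Literature.Computability.Complexity.LupanovBound

/-!
# `IqThreeNotPPoly` (stmt-QuantumAdvantage-2422) — a refuted strengthening and a refuted mutation

Negative-side lemmas for the crux `ArithStatLadder.IqThreeNotPPoly` (`IQ3 ∉ P/poly`), extracted from
the refuter work file `Summits/QuantumAdvantage/QuantumAdvantage/Cruxes/IqThreeNotPPoly/Disproof.lean`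
(refuter-cdisprove-stmt-QuantumAdvantage-2422-0, cycle 1). Sorry-free; axioms ⊆ {propext,
Classical.choice, Quot.sound}. No statement of the route is asserted positively.

* EXPONENTIAL STRENGTHENING IS FALSE: every language lies in `SIZE lupanovBound` (Lupanov's
  `(36 + o(1))·2ⁿ/n` bound of the tree, `cktSize_lupanov`, pushed to circuit families:
  `mem_SIZE_lupanovBound`), so "IQ3 ∉ SIZE(lupanovBound)" fails (`iqThree_mem_SIZE_lupanovBound`):
  any proof of the crux is necessarily quantitative below Lupanov. (Under GRH even
  `SIZE(2^{O(√(n log n))})` contains IQ3 — Hafner–McCurley + Adleman — not formalised.)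
* MODEL CAVEAT (already in the tree as `Summit.PneNP.Circuit.SIZE_eq_empty_of_apply_zero`,
  `Summits/PneNP/PneNP/Theorems/CircuitRefutations.lean`, not restated here): `SIZE s = ∅` as soon as
  `s 0 = 0`, so the Lupanov bound must be used in its `lupanovBound` form (`lupanovBound 0 = 21`), not
  as `fun n => 36 * 2 ^ n / n` (which is `0` at `n = 0` and defines the empty class).
* FINITE LANGUAGES ARE IN `P/poly` (`mem_PPoly_of_finite`: Lupanov below the length bound, one
  constant gate above), hence THE `h = 1` MUTATION IS FALSE: replacing `3 ∣ h(−d)` by `h(−d) = 1`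
  gives, by the class number one theorem (Heegner–Stark–Baker, PROVED in the tree:
  `mem_classNumberOneDiscrs_of_classNumber_eq_one_holds`), a set bounded by `163`
  (`iqOneSet_subset`), whose language is in `P/poly` (`iqOne_mem_PPoly`). The crux needs a condition
  with infinitely many fundamental solutions even to be non-trivial — for `3 ∣ h` this is Nagell 1922
  (and Hartung 1974 for the complement), quantitatively Davenport–Heilbronn.
-/

noncomputable section

namespace Summit.QuantumAdvantage.QuantumAdvantage.Theorems.IqThreeNotPPoly.Negative

open _root_.Computability Literature.Computability.Complexity
open Literature.Computability.Cryptography Literature.NumberTheory.QuadraticFields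

/-! ### Every language has Lupanov-size circuits -/

/-- **Every language is in `SIZE lupanovBound`** (tree theorem `cktSize_lupanov` at each length,
realised as a `Circuit` by `CktSize.toCircuit`). [folklore] -/
theorem mem_SIZE_lupanovBound (L : Language Bool) : L ∈ SIZE lupanovBound := by
  classical
  have key : ∀ n, ∃ C : Circuit (Fin n), C.IsOver B2 ∧ C.size ≤ lupanovBound n ∧
      ∀ x, C.eval x = L.boolIndicator (List.ofFn x) := fun n =>
    (cktSize_lupanov (n := n) fun v (_ : Unit) => L.boolIndicator (List.ofFn v)).toCircuit
  choose C hC using key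
  refine ⟨C, fun n => ⟨(hC n).1, (hC n).2.1⟩, fun x => ?_⟩
  rw [(hC x.length).2.2, List.ofFn_get]

/-- So the exponential strengthening of the crux, "IQ3 ∉ SIZE(lupanovBound)", is false: IQ3 (like
every language) IS in `SIZE lupanovBound`. [folklore] -/
theorem iqThree_mem_SIZE_lupanovBound :
    encodingNatBool.toLanguage
      {d : ℕ | IsNegFundamentalDiscr d ∧ 3 ∣ BinaryQuadraticForm.classNumber (-(d : ℤ))} ∈
        SIZE lupanovBound :=
  mem_SIZE_lupanovBound _

/-! ### Finite languages, and the `h = 1` mutation -/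

/-- **Finite languages have bounded-size circuit families** (Lupanov below the length bound, one
constant gate above it), hence lie in `P/poly`. [folklore] -/
theorem mem_PPoly_of_finite {L : Language Bool} (hL : (L : Set (List Bool)).Finite) : L ∈ PPoly := by
  classical
  obtain ⟨N, hN⟩ : ∃ N, ∀ x ∈ L, x.length ≤ N := by
    refine ⟨(hL.toFinset.image List.length).sup id, fun x hx => ?_⟩
    have hx' : x.length ∈ hL.toFinset.image List.length :=
      Finset.mem_image_of_mem _ (hL.mem_toFinset.2 hx)
    exact Finset.le_sup (f := id) hx'
  have keyS : ∀ n, ∃ C : Circuit (Fin n), C.IsOver B2 ∧ C.size ≤ lupanovBound n ∧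
      ∀ x, C.eval x = L.boolIndicator (List.ofFn x) := fun n =>
    (cktSize_lupanov (n := n) fun v (_ : Unit) => L.boolIndicator (List.ofFn v)).toCircuit
  have keyL : ∀ n, ∃ C : Circuit (Fin n), C.IsOver B2 ∧ C.size ≤ 1 ∧ ∀ x, C.eval x = false :=
    fun n => (cktSize_const (Fin n) false).toCircuit
  choose CS hCS using keyS
  choose CL hCL using keyL
  set M : ℕ := (Finset.range (N + 1)).sup lupanovBound + 1 with hM
  refine Set.mem_iUnion.2 ⟨Polynomial.C M, fun n => if n ≤ N then CS n else CL n,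
    fun n => ?_, fun x => ?_⟩
  · by_cases hn : n ≤ N
    · simp only [hn, if_true, Polynomial.eval_C]
      refine ⟨(hCS n).1, (hCS n).2.1.trans ?_⟩
      have : lupanovBound n ≤ (Finset.range (N + 1)).sup lupanovBound :=
        Finset.le_sup (f := lupanovBound) (Finset.mem_range.2 (Nat.lt_succ_of_le hn))
      omega
    · simp only [hn, if_false, Polynomial.eval_C]
      exact ⟨(hCL n).1, (hCL n).2.1.trans (by omega)⟩
  · show (if x.length ≤ N then CS x.length else CL x.length).eval x.get = L.boolIndicator x
    by_cases hx : x.length ≤ N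
    · simp only [hx, if_true]
      rw [(hCS x.length).2.2, List.ofFn_get]
    · simp only [hx, if_false]
      rw [(hCL x.length).2.2]
      have hxL : x ∉ L := fun h => hx (hN x h)
      exact ((L.notMem_iff_boolIndicator x).1 hxL).symm

/-- By the class number one theorem (PROVED in the tree,
`mem_classNumberOneDiscrs_of_classNumber_eq_one_holds`) the class-number-one set is bounded by
`163`. [folklore] -/
theorem iqOneSet_subset :
    {d : ℕ | IsNegFundamentalDiscr d ∧ BinaryQuadraticForm.classNumber (-(d : ℤ)) = 1} ⊆ Set.Iic 163 := by
  rintro d ⟨hF, h1⟩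
  have hd4 : 0 < d ∧ ((-(d : ℤ)) % 4 = 0 ∨ (-(d : ℤ)) % 4 = 1) := by
    rcases hF with ⟨h1', -, -⟩ | ⟨h4, h2, -⟩
    · exact ⟨by omega, Or.inr h1'⟩
    · refine ⟨?_, Or.inl (Int.emod_eq_zero_of_dvd h4)⟩
      rcases Nat.eq_zero_or_pos d with rfl | hd
      · norm_num at h2
      · exact hd
  have hmem := BinaryQuadraticForm.mem_classNumberOneDiscrs_of_classNumber_eq_one_holds
    (-(d : ℤ)) (by omega) hd4.2 h1
  have key : ∀ D ∈ BinaryQuadraticForm.classNumberOneDiscrs, -163 ≤ D := by decide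
  have h163 := key _ hmem
  show d ≤ 163
  omega

/-- **The `h = 1` mutation of the crux is false**: the class-number-one language is finite, hence in
`P/poly`. [folklore] -/
theorem iqOne_mem_PPoly :
    encodingNatBool.toLanguage
      {d : ℕ | IsNegFundamentalDiscr d ∧ BinaryQuadraticForm.classNumber (-(d : ℤ)) = 1} ∈ PPoly :=
  mem_PPoly_of_finite (((Set.finite_Iic 163).subset iqOneSet_subset).image _)

/-- The same, displayed as the negation of the mutated crux statement. [folklore] -/
theorem not_iqOne_not_mem_PPoly :
    ¬ (encodingNatBool.toLanguage
      {d : ℕ | IsNegFundamentalDiscr d ∧ BinaryQuadraticForm.classNumber (-(d : ℤ)) = 1} ∉ PPoly) :=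
  not_not.2 iqOne_mem_PPoly

end Summit.QuantumAdvantage.QuantumAdvantage.Theorems.IqThreeNotPPoly.Negative

end
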